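import Summits.Parity.GeneralizedHardyLittlewood.Theorems.BeyondDiagonalBeatsQuarter.OffDiagGoodPrimesDense
import HarnessLib

/-!
# Route `PrimeLevelFamEdge`, crux K_B (stmt-Parity-20343), line `diagonal_kernel_split` rev 4, plan Ω (KEYS-NEXT S1) —
# **add-back of the BAD primes: block sums over `goodPrimes Δ′ N` vs over ALL primes of `(N, 2N]`**

The heart's block sums run over `goodPrimes Δ′ N` (primes `q ∈ (N,2N]` with `q̂^{Δ′} ∉ ℕ`); the level-distribution inputs of
L7/L8 (Bombieri–Vinogradov / ABL 4.1 / explicit formula) speak of ALL primes of `(N,2N]`. The difference is carried by the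
bad primes, at most `(2N)^{Δ′/2}` of them (`OffDiag.card_badPrimes_le`, p637809), against `≫ N/log N` good ones:

* `goodPrimes_subset_primes` — `goodPrimes Δ′ N ⊆ (Ioc N (2N)).filter Prime`;
* **`abs_sum_primes_sub_sum_goodPrimes_le`** — for `F : ℕ → ℝ` with `|F q| ≤ B` (`B ≥ 0`) on the primes of `(N,2N]` (`Δ′ > 0`):
  `|Σ_{q prime ∈ (N,2N]} F q − Σ_{q ∈ goodPrimes Δ′ N} F q| ≤ (2N)^{Δ′/2}·B`;
* `norm_sum_primes_sub_sum_goodPrimes_le` — the same for `F : ℕ → ℂ`.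

Elementary; theorems only; standard axioms. Helper toward `stub_offDiagBelowSlack_io`; closes nothing.
«The programme SEARCHES and TYPES; no claim about Landau–Siegel zeros, Theorems 1–2 of arXiv:2211.02515 or
a repaired Margin232 until a kernel theorem says so.»
-/

noncomputable section

open Finset
open scoped Real

namespace Summit.Parity.GeneralizedHardyLittlewood.Theorems.BeyondDiagonalBeatsQuarter.OffDiag

open Literature.NumberTheory.LFunctions Literature.NumberTheory.LFunctions.KMV2000

open Classical in
/-- The good primes of a block are among the primes of `(N, 2N]`. [cite: KowalskiMichelVanderKam2000, §2 p. 7 (M ∉ ℤ)] -/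
theorem goodPrimes_subset_primes (Δ' : ℝ) (N : ℕ) :
    goodPrimes Δ' N ⊆ (Ioc N (2 * N)).filter Nat.Prime := by
  rw [goodPrimes_eq_filter]
  exact Finset.filter_subset _ _

open Classical in
/-- The set difference «primes of the block minus good primes» is the set of BAD primes (`q̂^{Δ′} ∈ ℕ`). [folklore] -/
theorem primes_sdiff_goodPrimes_eq (Δ' : ℝ) (N : ℕ) :
    (Ioc N (2 * N)).filter Nat.Prime \ goodPrimes Δ' N =
      ((Ioc N (2 * N)).filter Nat.Prime).filter
        (fun q : ℕ ↦ ¬ ∀ n : ℕ, (n : ℝ) ≠ (Real.sqrt (q : ℝ) / (2 * π)) ^ Δ') := by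
  rw [goodPrimes_eq_filter, Finset.sdiff_eq_filter]
  ext q
  simp only [Finset.mem_filter]
  tauto

open Classical in
/-- **Add-back of the bad primes (real weights).** If `|F q| ≤ B` for every prime `q ∈ (N,2N]` and `Δ′ > 0`, then
`|Σ_{q prime ∈ (N,2N]} F q − Σ_{q ∈ goodPrimes Δ′ N} F q| ≤ (2N)^{Δ′/2}·B`. [folklore] -/
theorem abs_sum_primes_sub_sum_goodPrimes_le {Δ' : ℝ} (h0 : 0 < Δ') (N : ℕ) {F : ℕ → ℝ} {B : ℝ} (hB0 : 0 ≤ B)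
    (hB : ∀ q ∈ (Ioc N (2 * N)).filter Nat.Prime, |F q| ≤ B) :
    |∑ q ∈ (Ioc N (2 * N)).filter Nat.Prime, F q - ∑ q ∈ goodPrimes Δ' N, F q| ≤
      (2 * (N : ℝ)) ^ (Δ' / 2) * B := by
  rw [← Finset.sum_sdiff (goodPrimes_subset_primes Δ' N), add_sub_cancel_right, primes_sdiff_goodPrimes_eq]
  calc |∑ q ∈ ((Ioc N (2 * N)).filter Nat.Prime).filter
          (fun q : ℕ ↦ ¬ ∀ n : ℕ, (n : ℝ) ≠ (Real.sqrt (q : ℝ) / (2 * π)) ^ Δ'), F q|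
      ≤ ∑ q ∈ ((Ioc N (2 * N)).filter Nat.Prime).filter
          (fun q : ℕ ↦ ¬ ∀ n : ℕ, (n : ℝ) ≠ (Real.sqrt (q : ℝ) / (2 * π)) ^ Δ'), |F q| := Finset.abs_sum_le_sum_abs _ _
    _ ≤ ∑ q ∈ ((Ioc N (2 * N)).filter Nat.Prime).filter
          (fun q : ℕ ↦ ¬ ∀ n : ℕ, (n : ℝ) ≠ (Real.sqrt (q : ℝ) / (2 * π)) ^ Δ'), B :=
        Finset.sum_le_sum fun q hq ↦ hB q (Finset.mem_filter.mp hq).1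
    _ = ((((Ioc N (2 * N)).filter Nat.Prime).filter
          (fun q : ℕ ↦ ¬ ∀ n : ℕ, (n : ℝ) ≠ (Real.sqrt (q : ℝ) / (2 * π)) ^ Δ')).card : ℝ) * B := by
        rw [Finset.sum_const, nsmul_eq_mul]
    _ ≤ (2 * (N : ℝ)) ^ (Δ' / 2) * B := mul_le_mul_of_nonneg_right (card_badPrimes_le h0 N) hB0

open Classical in
/-- **Add-back of the bad primes (complex weights).** [folklore] -/
theorem norm_sum_primes_sub_sum_goodPrimes_le {Δ' : ℝ} (h0 : 0 < Δ') (N : ℕ) {F : ℕ → ℂ} {B : ℝ} (hB0 : 0 ≤ B)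
    (hB : ∀ q ∈ (Ioc N (2 * N)).filter Nat.Prime, ‖F q‖ ≤ B) :
    ‖∑ q ∈ (Ioc N (2 * N)).filter Nat.Prime, F q - ∑ q ∈ goodPrimes Δ' N, F q‖ ≤
      (2 * (N : ℝ)) ^ (Δ' / 2) * B := by
  rw [← Finset.sum_sdiff (goodPrimes_subset_primes Δ' N), add_sub_cancel_right, primes_sdiff_goodPrimes_eq]
  calc ‖∑ q ∈ ((Ioc N (2 * N)).filter Nat.Prime).filter
          (fun q : ℕ ↦ ¬ ∀ n : ℕ, (n : ℝ) ≠ (Real.sqrt (q : ℝ) / (2 * π)) ^ Δ'), F q‖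
      ≤ ∑ q ∈ ((Ioc N (2 * N)).filter Nat.Prime).filter
          (fun q : ℕ ↦ ¬ ∀ n : ℕ, (n : ℝ) ≠ (Real.sqrt (q : ℝ) / (2 * π)) ^ Δ'), ‖F q‖ := norm_sum_le _ _
    _ ≤ ∑ q ∈ ((Ioc N (2 * N)).filter Nat.Prime).filter
          (fun q : ℕ ↦ ¬ ∀ n : ℕ, (n : ℝ) ≠ (Real.sqrt (q : ℝ) / (2 * π)) ^ Δ'), B :=
        Finset.sum_le_sum fun q hq ↦ hB q (Finset.mem_filter.mp hq).1
    _ = ((((Ioc N (2 * N)).filter Nat.Prime).filter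
          (fun q : ℕ ↦ ¬ ∀ n : ℕ, (n : ℝ) ≠ (Real.sqrt (q : ℝ) / (2 * π)) ^ Δ')).card : ℝ) * B := by
        rw [Finset.sum_const, nsmul_eq_mul]
    _ ≤ (2 * (N : ℝ)) ^ (Δ' / 2) * B := mul_le_mul_of_nonneg_right (card_badPrimes_le h0 N) hB0

end Summit.Parity.GeneralizedHardyLittlewood.Theorems.BeyondDiagonalBeatsQuarter.OffDiag
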